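import Summits.PneNP.PneNP.Theorems.ConvexRankGatesCaptureGRankShadow
import Summits.PneNP.PneNP.Theorems.ConvexRankGatesCaptureRailSum
import Summits.PneNP.PneNP.Theorems.ConvexRankGatesCaptureUniversalSum
import Summits.PneNP.PneNP.Theorems.Capture.Negative.LoadBearing
import Literature.Computability.AlgebraicComplexity.PermanentVsDeterminant
import Literature.Computability.AlgebraicComplexity.ValiantCompleteness
import Literature.Computability.Complexity.CircuitInputMap
import HarnessLib

/-!
# Crux `Capture` (stmt-PneNP-2659) — the VALIANT BARRIER: small Hamiltonian cycles (or small permanents)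
# give `Capture` with ONE GRANK gate per function; refuting the crux proves Valiant's hypothesis (dc form)

Assembly of the kernel-checked VALIANT BARRIER of the crux
`Summit.PneNP.PneNP.Theses.ConvexRankGates.Capture` of route PneNP/ConvexRankGates (idea card
`Cruxes/Capture/Ideas/permanent-shadow-bridge.md`, ideator 4, §4–§5 `CaptureOfSmallHC`, `NotCaptureImpValiant`;
leads c4/c5 dossiers `Cruxes/Capture/Lines/csp-spine-meet-to-join-dead-c{4,5}.md`; lead c6, 2026-08-17).

* `captureOfSmallHC` — if over SOME field `F` the Hamiltonian-cycle family `(HC_m)_m` has polynomially bounded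
  determinantal complexity, then `Capture` holds, indeed with simulating circuits of size ONE (a single GRANK gate).
  Proof: for a monotone `f : {0,1}^ι → {0,1}` with a `B₂`-circuit `C` of size `t`, transport to `Fin n`
  (`Circuit.mapInputs`), let `ℓ = |desc C|` be the length of the tree's circuit description; the universal rail
  circuit-sum `circuitSum (Q n ℓ)` has a determinantal representation of size `(n + ℓ + 2)^c`
  (`exists_hasDetRepr_evalRails`, part 3: Valiant's criterion + `VNP`-completeness of `HC`); the rail substitution
  `Y ↦ desc C`, `Y' ↦ ¬desc C` is a projection and turns it into `circuitSum C` (`aeval_railSubst_circuitSum`, part 2),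
  which therefore has a determinantal representation of the same size (`HasDetRepr.of_isProjection_holds`); its
  support shadow is one GRANK gate computing `f` (`isGRankGate_of_hasDetRepr_circuitSum`, part 1); and
  `n + ℓ + 2 ≤ (t + n + 2)^6` (`CircEval.length_desc_le`), so the gate lies in `B_{(t+n+2)^{6c}}`.
* `captureOfSmallPermanent` — the same from polynomially bounded `dc(PER_m)` over some field of characteristic `≠ 2`
  (the permanent is `VNP`-complete there, `isVNPComplete_perPoly_holds`; `HC ∈ VNP`, `isVNPFamily_hcPoly_holds`).
* `notCaptureImpValiant`, `dcPerSuperpolynomial_of_not_capture`, `dcPerSuperpolynomialComplex_of_not_capture` — the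
  contrapositives: ANY refutation of the crux (a third door, a lattice gate, the dual Tutte gate, …) is a proof that
  `dc(HC_m)` is superpolynomial over EVERY field and that `dc(PER_m)` is superpolynomial over every field of
  characteristic `≠ 2` — in particular a proof of the tree's registered OPEN CONJECTURE `DcPerSuperpolynomialComplex`
  (Valiant's hypothesis in determinantal form over `ℂ`, `PermanentVsDeterminant.lean`; best bound in print
  `dc(PER_m) ≥ m²/2`, Mignon–Ressayre 2004).

So the crux cannot be refuted in the kernel short of `VBP ≠ VNP`; this is the machine-checked form of the verdict
"conjecture-grade: refutation is VH-hard" of leads c1–c5. No new definitions. [folklore]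
-/

namespace Summit.PneNP.PneNP.Theorems.Capture.ValiantBarrier

set_option linter.dupNamespace false -- `Summit.PneNP.PneNP.…`: summit = sub-problem (D-0017)

open Literature.Computability.Complexity Literature.Computability.AlgebraicComplexity MvPolynomial
open Literature.Computability.AlgebraicComplexity.ValiantCriterion (circuitSum)
open Literature.Computability.AlgebraicComplexity.CircuitArith (toK)
open Literature.Computability.Complexity.CircEval (EvalLang desc)
open Summit.PneNP.PneNP.Theses.ConvexRankGates (Capture)
open Summit.PneNP.PneNP.Theorems.Capture.Negative (CaptureInto capture_iff)

/-- Size bookkeeping: the description length `ℓ ≤ (t+1)(8(n+t)+10)` of a circuit of size `t` on `n` inputs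
gives `n + ℓ + 2 ≤ (t + n + 2)^6`. [folklore] -/
theorem desc_budget {n t ℓ : ℕ} (hℓ : ℓ ≤ (t + 1) * (8 * (n + t) + 10)) : n + ℓ + 2 ≤ (t + n + 2) ^ 6 := by
  set b := t + n + 2 with hb_def
  have hb : 2 ≤ b := by omega
  have h1 : ℓ ≤ 8 * b ^ 2 := by nlinarith [hℓ]
  have h2 : n + ℓ + 2 ≤ 9 * b ^ 2 := by nlinarith [h1]
  have h3 : 16 ≤ b ^ 4 := by
    calc (16 : ℕ) = 2 ^ 4 := by norm_num
      _ ≤ b ^ 4 := Nat.pow_le_pow_left hb 4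
  calc n + ℓ + 2 ≤ 9 * b ^ 2 := h2
    _ ≤ b ^ 4 * b ^ 2 := Nat.mul_le_mul_right _ (by omega)
    _ = b ^ 6 := by ring

/-- The rail substitution `Xᵢ ↦ Xᵢ`, `Y_j ↦ [c_j]`, `Y'_j ↦ [¬c_j]` is a Valiant projection (variables or
constants). [folklore] -/
theorem rails_isProjectionMap {F : Type*} [CommRing F] {n ℓ : ℕ} (c : Fin ℓ → Bool) :
    ∀ t : Fin (n + (ℓ + ℓ)),
      (∃ j, Fin.append (fun i => (X i : MvPolynomial (Fin n) F))
          (Fin.append (fun j => C (toK F (c j))) (fun j => C (toK F (!c j)))) t = X j) ∨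
      ∃ a : F, Fin.append (fun i => (X i : MvPolynomial (Fin n) F))
          (Fin.append (fun j => C (toK F (c j))) (fun j => C (toK F (!c j)))) t = C a := by
  intro t
  refine Fin.addCases (fun i => ?_) (fun s => ?_) t
  · exact Or.inl ⟨i, by simp only [Fin.append_left]⟩
  · refine Fin.addCases (fun j => ?_) (fun j => ?_) s
    · exact Or.inr ⟨toK F (c j), by simp only [Fin.append_right, Fin.append_left]⟩
    · exact Or.inr ⟨toK F (!c j), by simp only [Fin.append_right]⟩

/-- **Capture into ONE GRANK gate from small Hamiltonian cycles.** If over some field `F` the family `(HC_m)` has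
p-bounded determinantal complexity, then every monotone `f` with a `B₂`-circuit of size `t` on `n` inputs is
computed by a size-`1` circuit whose gate is a GRANK gate of dimension `≤ (t + n + 2)^a`, for one absolute `a`. [folklore] -/
theorem captureInto_grank_of_smallHC {F : Type} [Field F]
    (hF : IsPBounded fun m => Literature.Computability.AlgebraicComplexity.determinantalComplexity
      (hcPoly (Fin m) F)) :
    ∃ a : ℕ, ∀ (ι : Type) (_ : Fintype ι) (f : (ι → Bool) → Bool), Monotone f →
      ∀ C : Circuit ι, C.IsOver B2 → C.Computes f →
        ∃ C' : Circuit ι, C'.IsOver {g | IsGRankGate ((C.size + Fintype.card ι + 2) ^ a) g} ∧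
          C'.size ≤ 1 ∧ C'.Computes f := by
  obtain ⟨c, Q, hQdet, hQeval⟩ := exists_hasDetRepr_evalRails F hF
  refine ⟨6 * c, fun ι _ f hf C hB hC => ?_⟩
  -- transport to `Fin n`
  set n := Fintype.card ι
  let e : ι ≃ Fin n := Fintype.equivFin ι
  let C₁ : Circuit (Fin n) := C.mapInputs e
  let f₁ : (Fin n → Bool) → Bool := fun u => f fun i => u (e i)
  have hB₁ : C₁.IsOver B2 := hB.mapInputs e
  have hC₁ : C₁.Computes f₁ := fun u => by
    show (C.mapInputs e).eval u = f fun i => u (e i)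
    rw [Circuit.eval_mapInputs, hC]
  have hf₁ : Monotone f₁ := fun u v huv => hf fun i => huv (e i)
  -- the description of `C₁` pins the rails
  set ℓ := (desc C₁).length
  let cd : Fin ℓ → Bool := (desc C₁).get
  have hslice : ∀ x : Fin n → Bool,
      C₁.eval x = EvalLang.boolIndicator (boolPair (List.ofFn x) (List.ofFn cd)) := fun x => by
    show C₁.eval x = EvalLang.boolIndicator (boolPair (List.ofFn x) (List.ofFn (desc C₁).get))
    rw [List.ofFn_get, boolIndicator_evalLang_ofFn C₁ hB₁ x]
  have hrail := aeval_railSubst_circuitSum (k := F) (Q n ℓ)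
    (fun x y => EvalLang.boolIndicator (boolPair (List.ofFn x) (List.ofFn y))) (hQeval n ℓ) cd C₁ hslice
  -- `circuitSum C₁` is a projection of the universal rail sum, hence has a small determinantal representation
  have hproj : IsProjection (circuitSum (k := F) C₁) (circuitSum (k := F) (Q n ℓ)) :=
    ⟨_, rails_isProjectionMap cd, hrail.symm⟩
  have hdet : HasDetRepr (circuitSum (k := F) C₁) ((n + ℓ + 2) ^ c) :=
    HasDetRepr.of_isProjection_holds (hQdet n ℓ) hproj
  -- one GRANK gate of dimension `(n + ℓ + 2)^c ≤ (t + n + 2)^(6c)`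
  have hg : IsGRankGate ((n + ℓ + 2) ^ c) ⟨n, f₁⟩ := isGRankGate_of_hasDetRepr_circuitSum hC₁ hf₁ hdet
  have hℓ : ℓ ≤ (C.size + 1) * (8 * (n + C.size) + 10) := by
    have := CircEval.length_desc_le C₁
    rwa [Circuit.size_mapInputs] at this
  have hdim : (n + ℓ + 2) ^ c ≤ (C.size + n + 2) ^ (6 * c) := by
    rw [pow_mul]
    exact Nat.pow_le_pow_left (desc_budget hℓ) c
  obtain ⟨C', hB', hs', hC'⟩ := (CktSize.gate (B := {g | IsGRankGate ((C.size + n + 2) ^ (6 * c)) g})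
    ⟨n, f₁⟩ (hg.mono hdim) e.symm).toCircuit
  refine ⟨C', hB', hs', fun x => ?_⟩
  rw [hC' x]
  show f (fun i => x (e.symm (e i))) = f x
  simp only [Equiv.symm_apply_apply]

/-- **`CaptureOfSmallHC`** (card permanent-shadow-bridge, §4): if over SOME field the Hamiltonian-cycle family has
polynomially bounded determinantal complexity (the negation of Valiant's hypothesis in `dc` form over that field;
`HC` is `VNP`-complete over every field, `isVNPComplete_hcPoly_holds`), then the crux `Capture` holds — with a
single GRANK gate per function. [folklore] -/
theorem captureOfSmallHC : (∃ (F : Type) (_ : Field F),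
      IsPBounded fun m => Literature.Computability.AlgebraicComplexity.determinantalComplexity (hcPoly (Fin m) F)) →
    Summit.PneNP.PneNP.Theses.ConvexRankGates.Capture := by
  rintro ⟨F, _, hF⟩
  rw [capture_iff]
  obtain ⟨a, ha⟩ := captureInto_grank_of_smallHC hF
  refine ⟨a, fun ι _ f hf C hB hC => ?_⟩
  obtain ⟨C', hB', hs', hC'⟩ := ha ι _ f hf C hB hC
  refine ⟨C', fun g hg' => IsGRankGate.mem_extGate (hB' g hg'), hs'.trans (Nat.one_le_pow _ _ (by omega)), hC'⟩

/-- Small permanents give small Hamiltonian cycles: over a field of characteristic `≠ 2` the permanent is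
`VNP`-complete (`isVNPComplete_perPoly_holds`) and `HC ∈ VNP` (`isVNPFamily_hcPoly_holds`, renamed to `Fin (m·m)`
variables), so `dc(HC_m) ≤ dc(PER_{t m})` with `t` p-bounded (`determinantalComplexity_le_of_isProjection_holds`).
[folklore] -/
theorem isPBounded_dc_hcPoly_of_perPoly {F : Type} [Field F] (h2 : ringChar F ≠ 2)
    (hF : IsPBounded fun m => Literature.Computability.AlgebraicComplexity.determinantalComplexity
      (perPoly (Fin m) F)) :
    IsPBounded fun m => Literature.Computability.AlgebraicComplexity.determinantalComplexity
      (hcPoly (Fin m) F) := by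
  have hVNP : IsVNPFamily (fun m => renameEquiv F (finProdFinEquiv (m := m) (n := m)) (hcPoly (Fin m) F)) :=
    IsVNPFamily.renameEquiv (fun m => finProdFinEquiv) (isVNPFamily_hcPoly_holds F)
  obtain ⟨t, ht, hproj⟩ := (isVNPComplete_perPoly_holds F h2).2 (fun m => m * m) _ hVNP
  refine (IsPBounded.comp_holds hF ht).mono fun m => ?_
  have h1 : IsProjection (hcPoly (Fin m) F) (renameEquiv F (finProdFinEquiv (m := m) (n := m)) (hcPoly (Fin m) F)) := by
    refine ⟨fun p => X (finProdFinEquiv.symm p), fun p => Or.inl ⟨_, rfl⟩, ?_⟩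
    rw [renameEquiv_apply, aeval_rename]
    have hcomp : ((fun p => (X (finProdFinEquiv.symm p) : MvPolynomial (Fin m × Fin m) F)) ∘
        (finProdFinEquiv (m := m) (n := m))) = X := by
      funext q
      simp only [Function.comp_apply, Equiv.symm_apply_apply]
    rw [hcomp, aeval_X_left_apply]
  exact determinantalComplexity_le_of_isProjection_holds (IsProjection.trans_holds h1 (hproj m))

/-- **`CaptureOfSmallPermanent`** (card permanent-shadow-bridge, §4): polynomially bounded `dc(PER_m)` over some
field of characteristic `≠ 2` gives the crux `Capture`. [folklore] -/
theorem captureOfSmallPermanent : (∃ (F : Type) (_ : Field F), ringChar F ≠ 2 ∧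
      IsPBounded fun m => Literature.Computability.AlgebraicComplexity.determinantalComplexity (perPoly (Fin m) F)) →
    Summit.PneNP.PneNP.Theses.ConvexRankGates.Capture := by
  rintro ⟨F, _, h2, hF⟩
  exact captureOfSmallHC ⟨F, inferInstance, isPBounded_dc_hcPoly_of_perPoly h2 hF⟩

/-- **`NotCaptureImpValiant`** (card permanent-shadow-bridge, §5; registered sub-goal `notCaptureImpValiant`):
every refutation of the crux `Capture` is a proof that the Hamiltonian-cycle family has superpolynomial
determinantal complexity over EVERY field (`VBP ≠ VNP` in every characteristic). [folklore] -/
theorem notCaptureImpValiant : ¬ Summit.PneNP.PneNP.Theses.ConvexRankGates.Capture → ∀ (F : Type) [Field F],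
    ¬ IsPBounded fun m => Literature.Computability.AlgebraicComplexity.determinantalComplexity (hcPoly (Fin m) F) :=
  fun h F _ hF => h (captureOfSmallHC ⟨F, inferInstance, hF⟩)

/-- Every refutation of `Capture` proves `dc(PER_m)` superpolynomial over every field of characteristic `≠ 2`
(`DcPerSuperpolynomial F`, Mulmuley–Sohoni / Bürgisser / Valiant, `PermanentVsDeterminant.lean`). [folklore] -/
theorem dcPerSuperpolynomial_of_not_capture : ¬ Summit.PneNP.PneNP.Theses.ConvexRankGates.Capture →
    ∀ (F : Type) [Field F], ringChar F ≠ 2 → DcPerSuperpolynomial F :=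
  fun h F _ h2 hF => h (captureOfSmallPermanent ⟨F, inferInstance, h2, hF⟩)

/-- **The barrier in the tree's conjecture vocabulary**: every refutation of the crux `Capture` proves the
registered OPEN CONJECTURE `DcPerSuperpolynomialComplex` — Valiant's hypothesis in determinantal-complexity form
over `ℂ` (`dc(PER_m)` is not polynomially bounded; best bound in print `m²/2`, Mignon–Ressayre 2004). [folklore] -/
theorem dcPerSuperpolynomialComplex_of_not_capture :
    ¬ Summit.PneNP.PneNP.Theses.ConvexRankGates.Capture → DcPerSuperpolynomialComplex :=
  fun h => dcPerSuperpolynomial_of_not_capture h ℂ (by rw [ringChar.eq_zero]; decide)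

end Summit.PneNP.PneNP.Theorems.Capture.ValiantBarrier
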